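import Summits.AnomalousDissipation.AnomalousDissipation.Theorems.BaireTransferRobustLoudUpgradeLine

/-!
# Line `malkin-cone-group-orbits`, stub `stub_fsigma_meagre` (lead c15) for the crux `BaireTransfer.RobustLoudUpgrade`
# (stmt-AnomalousDissipation-1144)

Pure topology, registered sub-goal `stub_fsigma_meagre` of the category package (§A of the c15 skeleton): for an `F_σ` set
`L = ⋃ₙ Fₙ` (all `Fₙ` closed), the non-interior part `L \ interior L` is MEAGRE.  Proof: `L \ interior L ⊆ ⋃ₙ (Fₙ \ interior Fₙ)`
because `interior Fₙ ⊆ interior L` (`interior_mono`); and `Fₙ \ interior Fₙ = frontier Fₙ` (`IsClosed.frontier_eq`) is closed with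
empty interior (`interior_frontier`), hence nowhere dense (`IsClosed.isNowhereDense_iff`), hence meagre (`IsNowhereDense.isMeagre`);
a countable union of meagre sets is meagre (`isMeagre_iUnion`, `IsMeagre.mono`).  The lead applies it to the mean-zero steady-loud
set of coefficient vectors, a countable union of closed strata.  References: Oxtoby, *Measure and Category* (1980) Ch. 9; Mathlib
`Mathlib/Topology/GDelta/Basic.lean`, `Mathlib/Topology/Closure.lean`.
-/

-- `Summit.<Summit>.<Problem>` is the tree's mandated summit-side namespace (CONVENTIONS §2); for this
-- single-conjunct summit the two coincide, so the duplicate is deliberate.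
set_option linter.dupNamespace false

open scoped Topology
open Filter Set Function TopologicalSpace

namespace Summit.AnomalousDissipation.AnomalousDissipation.Theorems.RobustLoudUpgrade.Category

/-- The non-interior part `F \ interior F` of a CLOSED set `F` (its frontier) is nowhere dense, hence meagre. [folklore] -/
theorem isMeagre_diff_interior_of_isClosed {X : Type*} [TopologicalSpace X] {F : Set X} (hF : IsClosed F) :
    IsMeagre (F \ interior F) := by
  rw [← hF.frontier_eq]
  exact (isClosed_frontier.isNowhereDense_iff.2 (interior_frontier hF)).isMeagre

/-- **stub_fsigma_meagre** (registered sub-goal, c15; pure topology).  A countable union of closed sets minus its interior is meagre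
(each `F n ∖ interior (F n)` is closed with empty interior, hence nowhere dense, and `interior (F n) ⊆ interior (⋃ F)`). [folklore] -/
theorem stub_fsigma_meagre : ∀ {X : Type} [TopologicalSpace X] (F : ℕ → Set X),
    (∀ n, IsClosed (F n)) → IsMeagre ((⋃ n, F n) \ interior (⋃ n, F n)) := by
  intro X _ F hF
  refine (isMeagre_iUnion fun n => isMeagre_diff_interior_of_isClosed (hF n)).mono ?_
  rintro x ⟨hx, hxi⟩
  obtain ⟨n, hn⟩ := Set.mem_iUnion.1 hx
  exact Set.mem_iUnion.2 ⟨n, hn, fun h => hxi (interior_mono (Set.subset_iUnion F n) h)⟩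

end Summit.AnomalousDissipation.AnomalousDissipation.Theorems.RobustLoudUpgrade.Category
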